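import Summits.QuantumFields.QCD.Theorems.QuarksAsStableActionCriticalLineDiamagnetismCellSecondOrderAux3
import Summits.QuantumFields.QCD.Theorems.QuarksAsStableActionCriticalLineDiamagnetismCellSecondOrderAux4
import Literature.Probability.LatticeModels.TorusMomentumSumBound

/-!
# B6 cell sub-stub `cellSecondOrder`, Aux 5: near pairs against the planar table, far pairs by decay, torus tails
(crux `stmt-QuantumFields-9734`, decl `Summit.QuantumFields.QCD.Theses.QuarksAsStableAction.CriticalLineDiamagnetism`,
line `Sketch`, Route B step B6; sub-problem context `Summits/QuantumFields/QCD/Statement.lean`)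

For a cell link at `x_c` and a partner link at `x_p` on the torus `(ℤ/L)²` (`L ≥ 23`, `M > 2`, `q = 2/M`, `γ = (1−q)⁻¹/M`,
`τ = q¹⁵ γ`):
* NEAR (`pairAbs_near_le`): if the pair is the projection of a planar pair `(a,b) + c`, `l′ + c` with `|l′ − (a,b)|₁ ≤ 7`, the
  four bubble traces of `pairAbs` are within `4 · 4τ(2γ + τ)` of the sign-free planar traces of `propTrunc 14` (planar
  identification `freeBlock_toTorus_approx` + the `4 × 4` stability estimate `bubble_term_approx`);
* FAR (`pairAbs_far_le`): `pairAbs x_c (x_c + v) ≤ 16 γ² q^{2(tdist v − 1)}` by the decay of the free propagator blocks;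
* registered `cellWalkFarSum` (`sum_torus_far_le`): `Σ_{tdist v ≥ k} x^{tdist v} ≤ 4(k+2) x^k/(1−x)²` on any torus
  `(ℤ/L)²` (folding each coordinate along `ZMod.valMinAbs`).
-/

noncomputable section

open scoped BigOperators Matrix Kronecker ComplexConjugate Matrix.Norms.L2Operator
open Matrix Literature.MathematicalPhysics.QuantumLattice
open Summit.QuantumFields.QCD.Cruxes.CriticalLineDiamagnetism.ChessboardCellGain.CellKappa

namespace Summit.QuantumFields.QCD.Cruxes.CriticalLineDiamagnetism.ChessboardCellGain.CellWalk

variable {L : ℕ} [NeZero L]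

/-- Uniform bound `‖G(u,v)‖ ≤ γ := (1 − 2/M)⁻¹/M`. -/
theorem norm_freeBlock_le_gamma (M s₀ s₁ : ℝ) (hM : 2 < M) (u v : ZMod L × ZMod L) :
    ‖freeBlock L M s₀ s₁ u v‖ ≤ (1 - 2 / M)⁻¹ * (1 / M) := by
  have hM0 : 0 < M := by linarith
  have hxq := l2_opNorm_xHop_le (L := L) M s₀ s₁ hM0
  have hq : 2 / M < 1 := (div_lt_one hM0).2 hM
  have hq0 : 0 ≤ 2 / M := by positivity
  refine (norm_freeBlock_le M s₀ s₁ hM0 hxq hq u v).trans ?_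
  have h1 : (2 / M) ^ tdist (u - v) ≤ 1 := pow_le_one₀ hq0 hq.le
  have h2 : 0 ≤ (1 - 2 / M)⁻¹ * (1 / M) := by
    have : 0 < 1 - 2 / M := by linarith
    positivity
  nlinarith

/-! ### 4 × 4 analysis -/

omit [NeZero L] in
/-- `|tr Z| ≤ 4 ‖Z‖` for a `4 × 4` matrix. -/
theorem norm_trace_le_four (Z : Matrix (Fin 4) (Fin 4) ℂ) : ‖Z.trace‖ ≤ 4 * ‖Z‖ := by
  rw [Matrix.trace]
  calc ‖∑ i, Z.diag i‖ ≤ ∑ i, ‖Z.diag i‖ := norm_sum_le _ _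
    _ ≤ ∑ _i : Fin 4, ‖Z‖ := Finset.sum_le_sum fun i _ => norm_apply_le_l2_opNorm Z i i
    _ = 4 * ‖Z‖ := by simp

omit [NeZero L] in
/-- **The bubble term is stable under the planar approximation.** -/
theorem bubble_term_approx (g₁ g₂ gJ₁ gJ₂ B₁ B₂ : Matrix (Fin 4) (Fin 4) ℂ) (c₁ c₂ : ℂ) (τ γ : ℝ)
    (hc₁ : ‖c₁‖ = 1) (hc₂ : ‖c₂‖ = 1) (h₁ : ‖g₁ - c₁ • gJ₁‖ ≤ τ) (h₂ : ‖g₂ - c₂ • gJ₂‖ ≤ τ) (hg₁ : ‖g₁‖ ≤ γ)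
    (hg₂ : ‖g₂‖ ≤ γ) (hB₁ : ‖B₁‖ ≤ 1) (hB₂ : ‖B₂‖ ≤ 1) (hτ : 0 ≤ τ) (hγ : 0 ≤ γ) :
    ‖(g₁ * B₁ * g₂ * B₂).trace‖ ≤ ‖(gJ₁ * B₁ * gJ₂ * B₂).trace‖ + 4 * τ * (2 * γ + τ) := by
  set R₁ := g₁ - c₁ • gJ₁ with hR₁
  set R₂ := g₂ - c₂ • gJ₂ with hR₂
  have hg1 : g₁ = c₁ • gJ₁ + R₁ := by rw [hR₁]; abel
  have hg2 : g₂ = c₂ • gJ₂ + R₂ := by rw [hR₂]; abel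
  have step1 : g₁ * B₁ * g₂ * B₂ = c₁ • (gJ₁ * B₁ * g₂ * B₂) + R₁ * B₁ * g₂ * B₂ := by
    rw [hg1]; simp only [Matrix.add_mul, Matrix.smul_mul]
  have step2 : gJ₁ * B₁ * g₂ * B₂ = c₂ • (gJ₁ * B₁ * gJ₂ * B₂) + gJ₁ * B₁ * R₂ * B₂ := by
    rw [hg2]; simp only [Matrix.mul_add, Matrix.add_mul, Matrix.mul_smul, Matrix.smul_mul]
  have hgJ₁ : ‖gJ₁‖ ≤ γ + τ := by
    have : c₁ • gJ₁ = g₁ - R₁ := by rw [hR₁]; abel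
    calc ‖gJ₁‖ = ‖c₁ • gJ₁‖ := by rw [norm_smul, hc₁, one_mul]
      _ = ‖g₁ - R₁‖ := by rw [this]
      _ ≤ ‖g₁‖ + ‖R₁‖ := norm_sub_le _ _
      _ ≤ γ + τ := add_le_add hg₁ h₁
  have hB1 : 0 ≤ ‖B₁‖ := norm_nonneg _
  have hB2 : 0 ≤ ‖B₂‖ := norm_nonneg _
  have e1 : ‖R₁ * B₁ * g₂ * B₂‖ ≤ τ * γ := by
    calc ‖R₁ * B₁ * g₂ * B₂‖ ≤ ‖R₁‖ * ‖B₁‖ * ‖g₂‖ * ‖B₂‖ := by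
          refine (norm_mul_le _ _).trans (mul_le_mul_of_nonneg_right ?_ hB2)
          exact (norm_mul_le _ _).trans (mul_le_mul_of_nonneg_right (norm_mul_le _ _) (norm_nonneg _))
      _ ≤ τ * 1 * γ * 1 := by gcongr
      _ = τ * γ := by ring
  have e2 : ‖gJ₁ * B₁ * R₂ * B₂‖ ≤ (γ + τ) * τ := by
    calc ‖gJ₁ * B₁ * R₂ * B₂‖ ≤ ‖gJ₁‖ * ‖B₁‖ * ‖R₂‖ * ‖B₂‖ := by
          refine (norm_mul_le _ _).trans (mul_le_mul_of_nonneg_right ?_ hB2)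
          exact (norm_mul_le _ _).trans (mul_le_mul_of_nonneg_right (norm_mul_le _ _) (norm_nonneg _))
      _ ≤ (γ + τ) * 1 * τ * 1 := by gcongr
      _ = (γ + τ) * τ := by ring
  have t1 : ‖(g₁ * B₁ * g₂ * B₂).trace‖ ≤ ‖(gJ₁ * B₁ * g₂ * B₂).trace‖ + 4 * (τ * γ) := by
    rw [step1, Matrix.trace_add, Matrix.trace_smul, smul_eq_mul]
    refine (norm_add_le _ _).trans (add_le_add ?_ ?_)
    · rw [norm_mul, hc₁, one_mul]
    · exact (norm_trace_le_four _).trans (by linarith)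
  have t2 : ‖(gJ₁ * B₁ * g₂ * B₂).trace‖ ≤ ‖(gJ₁ * B₁ * gJ₂ * B₂).trace‖ + 4 * ((γ + τ) * τ) := by
    rw [step2, Matrix.trace_add, Matrix.trace_smul, smul_eq_mul]
    refine (norm_add_le _ _).trans (add_le_add ?_ ?_)
    · rw [norm_mul, hc₂, one_mul]
    · exact (norm_trace_le_four _).trans (by linarith)
  nlinarith


/-! ### the near pair bound -/

/-- **Near pairs against the planar table.** -/
theorem pairAbs_near_le (M s₀ s₁ : ℝ) (hM : 2 < M) (a b : ℤ) (l' c : ℤ × ℤ) (hnear : |l'.1 - a| + |l'.2 - b| ≤ 7)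
    (hL : (23 : ℤ) ≤ L) :
    pairAbs L M s₀ s₁ (toTorus L ((a, b) + c)) (toTorus L (l' + c)) ≤
      (‖(propTrunc M s₀ s₁ 14 (a + 1 - l'.1, b - l'.2) * pMinus 2 * propTrunc M s₀ s₁ 14 (l'.1 + 1 - a, l'.2 - b) *
            pMinus 2).trace‖ +
        ‖(propTrunc M s₀ s₁ 14 (a + 1 - (l'.1 + 1), b - l'.2) * pPlus 2 * propTrunc M s₀ s₁ 14 (l'.1 - a, l'.2 - b) *
            pMinus 2).trace‖ +
        ‖(propTrunc M s₀ s₁ 14 (a - l'.1, b - l'.2) * pMinus 2 * propTrunc M s₀ s₁ 14 (l'.1 + 1 - (a + 1), l'.2 - b) *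
            pPlus 2).trace‖ +
        ‖(propTrunc M s₀ s₁ 14 (a - (l'.1 + 1), b - l'.2) * pPlus 2 * propTrunc M s₀ s₁ 14 (l'.1 - (a + 1), l'.2 - b) *
            pPlus 2).trace‖) +
      4 * (4 * ((2 / M) ^ (14 + 1) * (1 - 2 / M)⁻¹ * (1 / M)) *
        (2 * ((1 - 2 / M)⁻¹ * (1 / M)) + (2 / M) ^ (14 + 1) * (1 - 2 / M)⁻¹ * (1 / M))) := by
  set τ := (2 / M) ^ (14 + 1) * (1 - 2 / M)⁻¹ * (1 / M) with hτ
  set γ := (1 - 2 / M)⁻¹ * (1 / M) with hγ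
  have hM0 : 0 < M := by linarith
  have hq1 : 0 < 1 - 2 / M := by have := (div_lt_one hM0).2 hM; linarith
  have hτ0 : 0 ≤ τ := by positivity
  have hγ0 : 0 ≤ γ := by positivity
  have hc : ∀ u v : ℤ × ℤ, ‖liftSign L u * liftSign L v‖ = 1 := by
    intro u v; rw [norm_mul, norm_liftSign, norm_liftSign, one_mul]
  have hg : ∀ u v : ZMod L × ZMod L, ‖freeBlock L M s₀ s₁ u v‖ ≤ γ := norm_freeBlock_le_gamma M s₀ s₁ hM
  have hBm := l2_opNorm_pMinus_le 2
  have hBp := l2_opNorm_pPlus_le 2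
  -- the eight planar approximations
  have A : ∀ (u v w : ℤ × ℤ), (u.1 - v.1, u.2 - v.2) = w → |w.1| + |w.2| + 14 < L →
      ‖freeBlock L M s₀ s₁ (toTorus L u) (toTorus L v) - (liftSign L u * liftSign L v) • propTrunc M s₀ s₁ 14 w‖ ≤ τ :=
    fun u v w hw hL' => freeBlock_toTorus_approx M s₀ s₁ hM 14 u v w hw hL'
  have A1 := A ((a, b) + c + (1, 0)) (l' + c) (a + 1 - l'.1, b - l'.2) (Prod.ext (by simp only [Prod.fst_add]; ring) (by simp only [Prod.snd_add]; ring))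
    (by simp only [Int.abs_eq_natAbs] at hnear ⊢; omega)
  have A2 := A (l' + c + (1, 0)) ((a, b) + c) (l'.1 + 1 - a, l'.2 - b) (Prod.ext (by simp only [Prod.fst_add]; ring) (by simp only [Prod.snd_add]; ring))
    (by simp only [Int.abs_eq_natAbs] at hnear ⊢; omega)
  have A3 := A ((a, b) + c + (1, 0)) (l' + c + (1, 0)) (a + 1 - (l'.1 + 1), b - l'.2) (Prod.ext (by simp only [Prod.fst_add]; ring) (by simp only [Prod.snd_add]; ring))
    (by simp only [Int.abs_eq_natAbs] at hnear ⊢; omega)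
  have A4 := A (l' + c) ((a, b) + c) (l'.1 - a, l'.2 - b) (Prod.ext (by simp only [Prod.fst_add]; ring) (by simp only [Prod.snd_add]; ring))
    (by simp only [Int.abs_eq_natAbs] at hnear ⊢; omega)
  have A5 := A ((a, b) + c) (l' + c) (a - l'.1, b - l'.2) (Prod.ext (by simp only [Prod.fst_add]; ring) (by simp only [Prod.snd_add]; ring))
    (by simp only [Int.abs_eq_natAbs] at hnear ⊢; omega)
  have A6 := A (l' + c + (1, 0)) ((a, b) + c + (1, 0)) (l'.1 + 1 - (a + 1), l'.2 - b) (Prod.ext (by simp only [Prod.fst_add]; ring) (by simp only [Prod.snd_add]; ring))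
    (by simp only [Int.abs_eq_natAbs] at hnear ⊢; omega)
  have A7 := A ((a, b) + c) (l' + c + (1, 0)) (a - (l'.1 + 1), b - l'.2) (Prod.ext (by simp only [Prod.fst_add]; ring) (by simp only [Prod.snd_add]; ring))
    (by simp only [Int.abs_eq_natAbs] at hnear ⊢; omega)
  have A8 := A (l' + c) ((a, b) + c + (1, 0)) (l'.1 - (a + 1), l'.2 - b) (Prod.ext (by simp only [Prod.fst_add]; ring) (by simp only [Prod.snd_add]; ring))
    (by simp only [Int.abs_eq_natAbs] at hnear ⊢; omega)
  unfold pairAbs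
  rw [← toTorus_e1 (L := L), ← toTorus_add, ← toTorus_add]
  have b1 := bubble_term_approx _ _ _ _ _ _ _ _ τ γ (hc _ _) (hc _ _) A1 A2 (hg _ _) (hg _ _) hBm hBm hτ0 hγ0
  have b2 := bubble_term_approx _ _ _ _ _ _ _ _ τ γ (hc _ _) (hc _ _) A3 A4 (hg _ _) (hg _ _) hBp hBm hτ0 hγ0
  have b3 := bubble_term_approx _ _ _ _ _ _ _ _ τ γ (hc _ _) (hc _ _) A5 A6 (hg _ _) (hg _ _) hBm hBp hτ0 hγ0
  have b4 := bubble_term_approx _ _ _ _ _ _ _ _ τ γ (hc _ _) (hc _ _) A7 A8 (hg _ _) (hg _ _) hBp hBp hτ0 hγ0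
  linarith

/-! ### the far pair bound -/

omit [NeZero L] in
/-- The torus distance is even. -/
theorem tdist_neg (w : ZMod L × ZMod L) : tdist (-w) = tdist w := by
  simp [tdist, ZMod.natAbs_valMinAbs_neg]

/-- **Far pairs by decay.** -/
theorem pairAbs_far_le (M s₀ s₁ : ℝ) (hM : 2 < M) (xc v : ZMod L × ZMod L) :
    pairAbs L M s₀ s₁ xc (xc + v) ≤ 16 * ((1 - 2 / M)⁻¹ * (1 / M)) ^ 2 * ((2 / M) ^ (tdist v - 1)) ^ 2 := by
  set q := 2 / M with hqdef
  set γ := (1 - 2 / M)⁻¹ * (1 / M) with hγ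
  have hM0 : 0 < M := by linarith
  have hq : q < 1 := (div_lt_one hM0).2 hM
  have hq0 : 0 ≤ q := by positivity
  have hq1 : 0 < 1 - 2 / M := by linarith
  have hγ0 : 0 ≤ γ := by positivity
  have hxq := l2_opNorm_xHop_le (L := L) M s₀ s₁ hM0
  have key : ∀ u v' : ZMod L × ZMod L, tdist v ≤ tdist (u - v') + 1 →
      ‖freeBlock L M s₀ s₁ u v'‖ ≤ q ^ (tdist v - 1) * γ := by
    intro u v' h
    refine (norm_freeBlock_le M s₀ s₁ hM0 hxq hq u v').trans ?_
    rw [hγ, ← mul_assoc]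
    refine mul_le_mul_of_nonneg_right (mul_le_mul_of_nonneg_right ?_ (inv_nonneg.2 hq1.le)) (by positivity)
    exact pow_le_pow_of_le_one hq0 hq.le (by omega)
  have term : ∀ (g g' B B' : Matrix (Fin 4) (Fin 4) ℂ), ‖g‖ ≤ q ^ (tdist v - 1) * γ → ‖g'‖ ≤ q ^ (tdist v - 1) * γ →
      ‖B‖ ≤ 1 → ‖B'‖ ≤ 1 → ‖(g * B * g' * B').trace‖ ≤ 4 * (q ^ (tdist v - 1) * γ) ^ 2 := by
    intro g g' B B' h1 h2 h3 h4
    have h0 : 0 ≤ q ^ (tdist v - 1) * γ := by positivity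
    refine (norm_trace_le_four _).trans ?_
    have : ‖g * B * g' * B'‖ ≤ (q ^ (tdist v - 1) * γ) ^ 2 := by
      calc ‖g * B * g' * B'‖ ≤ ‖g‖ * ‖B‖ * ‖g'‖ * ‖B'‖ := by
            refine (norm_mul_le _ _).trans (mul_le_mul_of_nonneg_right ?_ (norm_nonneg _))
            exact (norm_mul_le _ _).trans (mul_le_mul_of_nonneg_right (norm_mul_le _ _) (norm_nonneg _))
        _ ≤ (q ^ (tdist v - 1) * γ) * 1 * (q ^ (tdist v - 1) * γ) * 1 := by
            gcongr
        _ = (q ^ (tdist v - 1) * γ) ^ 2 := by ring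
    linarith
  have hBm := l2_opNorm_pMinus_le 2
  have hBp := l2_opNorm_pPlus_le 2
  have hv1 : tdist v ≤ tdist ((1, 0) - v) + 1 := by
    have := tdist_sub_le ((1, 0) - v) (1, 0) (Or.inl rfl)
    rwa [show (1, 0) - v - (1, 0) = -v by abel, tdist_neg] at this
  have hv2 : tdist v ≤ tdist (v + (1, 0)) + 1 := by
    have := tdist_sub_le (v + (1, 0)) (1, 0) (Or.inl rfl)
    rwa [add_sub_cancel_right] at this
  have hv3 : tdist v ≤ tdist (v - (1, 0)) + 1 := by
    have := tdist_add_le (v - (1, 0)) (1, 0) (Or.inl rfl)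
    rwa [sub_add_cancel] at this
  have d1 := key (xc + (1, 0)) (xc + v) (by rw [show xc + (1, 0) - (xc + v) = (1, 0) - v by abel]; exact hv1)
  have d2 := key (xc + v + (1, 0)) xc (by rw [show xc + v + (1, 0) - xc = v + (1, 0) by abel]; exact hv2)
  have d3 := key (xc + (1, 0)) (xc + v + (1, 0)) (by rw [show xc + (1, 0) - (xc + v + (1, 0)) = -v by abel, tdist_neg]; omega)
  have d4 := key (xc + v) xc (by rw [show xc + v - xc = v by abel]; omega)
  have d5 := key xc (xc + v) (by rw [show xc - (xc + v) = -v by abel, tdist_neg]; omega)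
  have d6 := key (xc + v + (1, 0)) (xc + (1, 0)) (by rw [show xc + v + (1, 0) - (xc + (1, 0)) = v by abel]; omega)
  have d7 := key xc (xc + v + (1, 0)) (by rw [show xc - (xc + v + (1, 0)) = -(v + (1, 0)) by abel, tdist_neg]; exact hv2)
  have d8 := key (xc + v) (xc + (1, 0)) (by rw [show xc + v - (xc + (1, 0)) = v - (1, 0) by abel]; exact hv3)
  unfold pairAbs
  have t1 := term _ _ _ _ d1 d2 hBm hBm
  have t2 := term _ _ _ _ d3 d4 hBp hBm
  have t3 := term _ _ _ _ d5 d6 hBm hBp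
  have t4 := term _ _ _ _ d7 d8 hBp hBp
  nlinarith


/-! ### geometric sums over the torus -/

omit [NeZero L] in
/-- One coordinate: `Σ_{a ∈ ℤ/L} [j ≤ |a|] x^{|a|} ≤ [j = 0] + 2 x^j / (1 − x)`. -/
theorem sum_zmod_tail_le [NeZero L] (x : ℝ) (hx0 : 0 ≤ x) (hx1 : x < 1) (j : ℕ) :
    ∑ a : ZMod L, (if j ≤ a.valMinAbs.natAbs then x ^ a.valMinAbs.natAbs else 0) ≤
      (if j = 0 then 1 else 0) + 2 * (x ^ j / (1 - x)) := by
  have hg : ∀ d : ℕ, 0 ≤ (if j ≤ d then x ^ d else 0 : ℝ) := fun d => by split_ifs <;> positivity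
  refine (Literature.Probability.LatticeModels.sum_zmod_le_of_valMinAbs L (fun d => if j ≤ d then x ^ d else 0) hg).trans ?_
  refine add_le_add ?_ (mul_le_mul_of_nonneg_left ?_ (by norm_num))
  · by_cases hj : j = 0
    · subst hj; simp
    · rw [if_neg (by omega), if_neg hj]
  · calc ∑ d ∈ Finset.Icc 1 (L / 2), (if j ≤ d then x ^ d else 0)
        = ∑ d ∈ (Finset.Icc 1 (L / 2)).filter (fun d => j ≤ d), x ^ d := by rw [Finset.sum_filter]
      _ ≤ ∑ d ∈ Finset.Ico j (L / 2 + 1), x ^ d := by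
          refine Finset.sum_le_sum_of_subset_of_nonneg ?_ (fun _ _ _ => by positivity)
          intro d hd
          simp only [Finset.mem_filter, Finset.mem_Icc] at hd
          simp only [Finset.mem_Ico]
          omega
      _ ≤ x ^ j / (1 - x) := geom_sum_Ico_le_of_lt_one hx0 hx1

/-- **The far tail over the torus**: `Σ_{v : tdist v ≥ k} x^{tdist v} ≤ 4 (k + 2) x^k / (1 − x)²` for `k ≥ 1`. -/
theorem sum_torus_far_le (x : ℝ) (hx0 : 0 ≤ x) (hx1 : x < 1) (k : ℕ) (hk : 1 ≤ k) :
    ∑ v : ZMod L × ZMod L, (if k ≤ tdist v then x ^ tdist v else 0) ≤ 4 * (k + 2) * x ^ k / (1 - x) ^ 2 := by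
  set f : ℕ → ℕ → ℝ := fun j d => if j ≤ d then x ^ d else 0 with hf
  have hf0 : ∀ j d, 0 ≤ f j d := fun j d => by simp only [hf]; split_ifs <;> positivity
  -- pointwise decomposition of the indicator
  have hpt : ∀ v : ZMod L × ZMod L, (if k ≤ tdist v then x ^ tdist v else 0) ≤
      ∑ j ∈ Finset.range (k + 1), f j v.1.valMinAbs.natAbs * f (k - j) v.2.valMinAbs.natAbs := by
    intro v
    have hnn : ∀ j ∈ Finset.range (k + 1), 0 ≤ f j v.1.valMinAbs.natAbs * f (k - j) v.2.valMinAbs.natAbs :=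
      fun j _ => mul_nonneg (hf0 _ _) (hf0 _ _)
    split_ifs with h
    · have hj₀ : min v.1.valMinAbs.natAbs k ∈ Finset.range (k + 1) := by simp
      refine le_trans (le_of_eq ?_) (Finset.single_le_sum hnn hj₀)
      simp only [hf, tdist] at h ⊢
      rw [if_pos (min_le_left _ _), if_pos (by omega), ← pow_add]
    · exact Finset.sum_nonneg hnn
  -- one-dimensional bound
  set t := (1 - x)⁻¹ with ht
  have ht1 : 1 ≤ t := by rw [ht]; exact one_le_inv_iff₀.2 ⟨by linarith, by linarith⟩
  have ht0 : 0 ≤ t := by linarith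
  set B : ℕ → ℝ := fun j => (if j = 0 then 1 else 0) + 2 * x ^ j * t with hB
  have hB0 : ∀ j, 0 ≤ B j := fun j => by simp only [hB]; split_ifs <;> positivity
  have h1d : ∀ j, ∑ a : ZMod L, f j a.valMinAbs.natAbs ≤ B j := by
    intro j
    have := sum_zmod_tail_le (L := L) x hx0 hx1 j
    simp only [hf, hB, ht, div_eq_mul_inv] at this ⊢
    linarith
  -- summands of the convolution
  have hxk : ∀ j, j ≤ k → x ^ j * x ^ (k - j) = x ^ k := fun j hj => by rw [← pow_add, Nat.add_sub_cancel' hj]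
  have hsummand : ∀ j ∈ Finset.range (k + 1), B j * B (k - j) ≤
      4 * x ^ k * t ^ 2 + ((if j = 0 then 2 * x ^ k * t else 0) + (if j = k then 2 * x ^ k * t else 0)) := by
    intro j hj
    have hjk : j ≤ k := Nat.lt_succ_iff.mp (Finset.mem_range.1 hj)
    have e := hxk j hjk
    simp only [hB]
    by_cases h0 : j = 0
    · subst h0
      have hk0 : k ≠ 0 := by omega
      rw [if_pos rfl, if_neg (by omega), if_pos rfl, if_neg (Ne.symm hk0), Nat.sub_zero, pow_zero]
      nlinarith [pow_nonneg hx0 k]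
    · by_cases hk' : j = k
      · subst hk'
        rw [if_neg h0, if_pos (Nat.sub_self j), if_neg h0, if_pos rfl, Nat.sub_self, pow_zero]
        nlinarith [pow_nonneg hx0 j]
      · rw [if_neg h0, if_neg (by omega), if_neg h0, if_neg hk']
        nlinarith [e, pow_nonneg hx0 j, pow_nonneg hx0 (k - j)]
  calc ∑ v : ZMod L × ZMod L, (if k ≤ tdist v then x ^ tdist v else 0)
      ≤ ∑ v : ZMod L × ZMod L, ∑ j ∈ Finset.range (k + 1), f j v.1.valMinAbs.natAbs * f (k - j) v.2.valMinAbs.natAbs :=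
        Finset.sum_le_sum fun v _ => hpt v
    _ = ∑ j ∈ Finset.range (k + 1), (∑ a : ZMod L, f j a.valMinAbs.natAbs) * (∑ b : ZMod L, f (k - j) b.valMinAbs.natAbs) := by
        rw [Finset.sum_comm]
        refine Finset.sum_congr rfl fun j _ => ?_
        rw [Fintype.sum_prod_type, Finset.sum_mul_sum]
    _ ≤ ∑ j ∈ Finset.range (k + 1), B j * B (k - j) :=
        Finset.sum_le_sum fun j _ => mul_le_mul (h1d j) (h1d (k - j)) (Finset.sum_nonneg fun b _ => hf0 _ _) (hB0 j)
    _ ≤ ∑ j ∈ Finset.range (k + 1),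
          (4 * x ^ k * t ^ 2 + ((if j = 0 then 2 * x ^ k * t else 0) + (if j = k then 2 * x ^ k * t else 0))) :=
        Finset.sum_le_sum hsummand
    _ = (k + 1) * (4 * x ^ k * t ^ 2) + (2 * x ^ k * t + 2 * x ^ k * t) := by
        rw [Finset.sum_add_distrib, Finset.sum_add_distrib, Finset.sum_const, Finset.card_range, Finset.sum_ite_eq',
          Finset.sum_ite_eq', if_pos (by simp), if_pos (by simp)]
        simp
    _ ≤ 4 * (k + 2) * x ^ k / (1 - x) ^ 2 := by
        rw [div_eq_mul_inv, ← inv_pow, ← ht]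
        have hxk0 : 0 ≤ x ^ k := pow_nonneg hx0 k
        nlinarith [mul_nonneg hxk0 ht0]



/-! ### Registered summary -/

/-- **Aux theorem `cellWalkFarSum`** (registered helper of `cellSecondOrder`): the geometric far tail over any torus
`(ℤ/L)²`, `Σ_{tdist v ≥ k} x^{tdist v} ≤ 4 (k + 2) x^k / (1 − x)²` for `0 ≤ x < 1`, `k ≥ 1`. -/
theorem cellWalkFarSum : ∀ (L : ℕ) [NeZero L] (x : ℝ), 0 ≤ x → x < 1 → ∀ (k : ℕ), 1 ≤ k → ∑ v : ZMod L × ZMod L, (if k ≤ tdist v then x ^ tdist v else 0) ≤ 4 * (k + 2) * x ^ k / (1 - x) ^ 2 :=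
  fun _ _ x hx0 hx1 k hk => sum_torus_far_le x hx0 hx1 k hk

end Summit.QuantumFields.QCD.Cruxes.CriticalLineDiamagnetism.ChessboardCellGain.CellWalk

end
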